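import Literature.AnabelianGeometry.EtaleTheta.Discharge.Sec1Prop15iiiOfThetaKummerInput
import Literature.AnabelianGeometry.EtaleTheta.ThetaKummerInputDeckOfCore
import Literature.AnabelianGeometry.EtaleTheta.KummerDataYCoord
import HarnessLib

/-!
# The «`c·Ü^r·Θ̈^s`» FUNCTION MODULE from an exponent cocycle: a `ThetaKummerInput` carrying EVERY binder of the
# function-level Prop 1.5 (iii) theorem — and Prop 1.5 (iii) for the inflated `z`-class (proof-only, generic)

S. Mochizuki, *The étale theta function and its Frobenioid-theoretic manifestations*, Publ. RIMS **45** (2009)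
[EtTh], §1: Prop 1.3 p. 21 (Kummer classes of constants, `η̈^Θ` as a Kummer class), Prop 1.4 (ii) p. 22
(«`Θ̈(q_X^{a/2} Ü) = (−1)^a q_X^{−a²/2} Ü^{−2a} Θ̈(Ü)`», «`Θ̈(−Ü) = −Θ̈(Ü)`»), Prop 1.4 (iii) p. 22 («the Kummer
classes associated to `O^×_K̈`-multiples of `Θ̈`»), Prop 1.5 (iii) p. 23 (the `Z`-action display; printed proof:
«Assertion (iii) follows from Propositions 1.3; 1.4, (ii), (iii)») [cite: MochizukiEtTh2009, Prop 1.5 (iii) p.23].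
Classical here. abc-iut cell, layer L2, seat abc-iut-L2-t12 (gen 8), row (β) «NV TWIN of p458029» — part 1/3
(generic). PROOF-ONLY (NO definition, NO `Prop` fact, NO instance; every object is built inside the existence
proof, as in abc-iut-w5-d125's `ThetaKummerInputDeckOfCore.lean`, whose `Ü`-monomial module `ℚ̄_pˣ × ℚ` this file
extends by the second generator `Θ̈`).

WHAT. Over a theta setting `D` with a Kummer core `C` (abc-iut-w5-d171) whose coefficients / `log(Ü)` come from a
`y`-coordinate kit `K` (`KummerDataYCoord`), a continuous `z`-cocycle `Z` on `(Π^tp_Y)^Θ` (the NAMED lift `x′`), a deck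
generator `σ₀` (`toZ σ₀ = 1`) and a **1-cocycle `B : Π^tp_X → Hom(ℚ², ℚ̄_pˣ)` of the EXPONENT MODULE** (for the action
`g ⋆ F := aug(g) ∘ F ∘ u_g⁻¹`, `u_g(r, s) := (r − 2·toZ(g)·s, s)` = «`Θ̈ ↦ Ü^{−2a}·Θ̈`» on exponents) whose `Π^tp_Ÿ`-values on
the roots are the Kummer characters of `log(Ü)` and of `x′` and whose value at `σ₀` is `(±q̈, q̈⁻¹)` on the generators,
`KummerCore.exists_thetaKummerInput_of_exponentCocycle` builds the MONOMIAL MODULE `Fn := ℚ̄_pˣ × ℚ × ℚ`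
(`g • (c, v) := (aug(g)c · B(g)(u_g v), u_g v)`; `Ü := (1,1,0)`, `Θ̈ := (1,0,1)`, roots `(1,1/N,0)`, `(1,0,1/N)`, constants
`(c,0,0)`, coefficients `Λ(Fn) = Λ(ℚ̄_pˣ) ≅ Δ_Θ`) as a `ThetaKummerInput` realising ALL binders of abc-iut-L2-t12's
`KummerCore.prop15iii_etaleThetaDataOfClass_of_thetaKummerInput` (p458029): bijective coefficients, `ConstCompat`,
`infl log(Ü) = κ(Ü)`, `infl x′ = κ(Θ̈)`, and the four FUNCTION identities of Prop 1.4 (ii) — `σ₀ • Ü = const(±q̈)·Ü`,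
`y • Ü = const(±1)·Ü`, `σ₀ • Θ̈ = const(q̈⁻¹)·Ü⁻²·Θ̈`, `y • Θ̈ = Θ̈` (`y ∈ Π^tp_Y`). Parts 2/3 (to follow): `B` from a cocycle on
`Π^tp_Y` + a value at `σ₀` (extension along `Π^tp_X = Π^tp_Y ⋊ σ₀^ℤ`), and the instance at `ThetaSetting.modelχq p 1 2`
(`x′ = zClassYddχq`, `infl x′ = etaDdχq`) with Prop 1.5 (iii) there re-derived through p458029.
HONEST FRAMING: algebra over the frozen interface; consistency / non-vacuity evidence for the typed §1 interface only;
nothing of [EtTh] is asserted; typed ≠ proved; no side is taken on [IUTchIII] Cor 3.12.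
-/

noncomputable section

namespace Literature.AnabelianGeometry.EtaleTheta

open Literature.AnabelianGeometry.SemiGraphs

namespace ThetaSetting

namespace KummerCore

variable {p : ℕ} [Fact p.Prime] {D : ThetaSetting p} (C : D.KummerCore)

/-- **A `ThetaKummerInput` realising EVERY binder of the function-level Prop 1.5 (iii) theorem, from an exponent
cocycle.** Data: a Kummer core `C` whose `log(Ü)` / coefficients come from the `y`-coordinate kit `K` (`hKU`, `hKι`);
a continuous cocycle `Z` on `(Π^tp_Y)^Θ` (its restriction `x′` to `(Π^tp_Ÿ)^Θ` is the `Θ`-lift); `σ₀` with `toZ σ₀ = 1`;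
a map `B : Π^tp_X → Hom(ℚ × ℚ, ℚ̄_pˣ)` with (hB) the cocycle law for
`g ⋆ F = aug(g) ∘ F ∘ u_g⁻¹`, (hBopen) locally constant on `Π^tp_Y`, (hBYU/hBYT) `Π^tp_Y`-values `±1` resp. `1` on the
generators, (hBlogU/hBZ) `Π^tp_Ÿ`-values on the roots = the Kummer characters of `log(Ü) = ι(ŷ/2)` and of `Z`, and
(hB0U/hB0T) `B(σ₀)(1,0) = ±q̈`, `B(σ₀)(−2,1) = q̈⁻¹`. Conclusion: the monomial module `ℚ̄_pˣ × ℚ × ℚ` is a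
`ThetaKummerInput` `T` with `Ü := (1,1,0)` and: bijective `Λ(Fn) → Δ_Θ`, `ConstCompat`, `infl log(Ü) = κ(Ü)`,
`infl x′ = κ(Θ̈)`, `σ₀ • Ü = const(u·q̈)·Ü`, `y • Ü = const(±1)·Ü`, `σ₀ • Θ̈ = const(q̈⁻¹)·Ü⁻²·Θ̈`, `y • Θ̈ = Θ̈`.
[cite: MochizukiEtTh2009, Prop 1.4 (ii) p.22] -/
theorem exists_thetaKummerInput_of_exponentCocycle
    (K : D.YCoordKit) (hKU : C.logUdd = K.logUdd)
    (hKι : ∀ t : SettingModel.ZH, C.coeffHom ((SettingModel.cycEquiv p).symm t) = K.iota t)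
    (Z : ↥(D.GtpY.map D.toTheta) → D.DeltaTheta)
    (hZ : Z ∈ contCocycles (MonoidHom.id D.GtpTheta) D.DeltaTheta (D.GtpY.map D.toTheta))
    (σ₀ : D.PiTemp) (hσ₀ : D.toZ σ₀ = Multiplicative.ofAdd 1)
    (B : D.PiTemp → (Multiplicative ℚ × Multiplicative ℚ →* (PadicAlgCl p)ˣ))
    (hB : ∀ (g h : D.PiTemp) (v : Multiplicative ℚ × Multiplicative ℚ),
      B (g * h) v = B g v * D.aug g • B h (v.1 * v.2 ^ (2 * Multiplicative.toAdd (D.toZ g)), v.2))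
    (hBopen : ∀ v : Multiplicative ℚ × Multiplicative ℚ, IsOpen {g : D.PiTemp | g ∈ D.GtpY ∧ B g v = 1})
    (hBYU : ∀ y ∈ D.GtpY, B y (Multiplicative.ofAdd 1, 1) = 1 ∨ B y (Multiplicative.ofAdd 1, 1) = -1)
    (hBYT : ∀ y ∈ D.GtpY, B y (1, Multiplicative.ofAdd 1) = 1)
    (hBlogU : ∀ (h : D.PiTemp) (hh : h ∈ D.GtpYdd) (n : ℕ+),
      B h (Multiplicative.ofAdd ((1 : ℚ) / (n : ℕ)), 1) =
        (((SettingModel.cycEquiv p).symm (SettingModel.half ⟨K.y (D.toTheta h), K.y_even _ ⟨h, hh, rfl⟩⟩) :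
          cyclotome (PadicAlgCl p)ˣ) : ℕ+ → (PadicAlgCl p)ˣ) n)
    (hBZ : ∀ (h : D.PiTemp) (hh : h ∈ D.GtpYdd) (n : ℕ+),
      B h (1, Multiplicative.ofAdd ((1 : ℚ) / (n : ℕ))) =
        (((MulEquiv.ofBijective C.coeffHom C.bijective_coeffHom).symm
            (Z ⟨D.toTheta h, D.GtpYddTheta_le ⟨h, hh, rfl⟩⟩) : cyclotome (PadicAlgCl p)ˣ) : ℕ+ → (PadicAlgCl p)ˣ) n)
    (u₀ : (PadicAlgCl p)ˣ) (hu₀ : u₀ = 1 ∨ u₀ = -1)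
    (hB0U : B σ₀ (Multiplicative.ofAdd 1, 1) = u₀ * Units.mk0 D.qdd D.qdd_ne_zero)
    (hB0T : B σ₀ (Multiplicative.ofAdd (-2), Multiplicative.ofAdd 1) = (Units.mk0 D.qdd D.qdd_ne_zero)⁻¹) :
    ∃ (T : D.ThetaKummerInput) (udd : T.Fn) (hu : udd ∈ MulAction.fixedPoints D.GtpYdd T.Fn) (w : RootSystem udd),
      Function.Bijective T.coeff.hom ∧ T.ConstCompat C.toKummerData ∧
      D.inflTheta D.GtpYdd C.logUdd = T.coeff.kummerContClass D.GtpYdd w hu (fun _ => T.isOpen_stabilizer _) ∧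
      D.inflTheta D.GtpYdd
          (ContH1.res (MonoidHom.id D.GtpTheta) D.DeltaTheta D.GtpYddTheta_le (ContH1.mk Z hZ)) = T.kummerTheta ∧
      (∃ u ∈ D.unitsOKdd, σ₀ • udd = T.const (u * D.qddUnit) * udd) ∧
      (∀ y ∈ D.GtpY, ∃ u ∈ D.unitsOKdd, y • udd = T.const u * udd) ∧
      (∃ u ∈ D.unitsOKdd, σ₀ • T.theta = T.const (u * D.qddUnit⁻¹) * udd ^ (-(2 : ℤ)) * T.theta) ∧
      (∀ y ∈ D.GtpY, ∃ u ∈ D.unitsOKdd, y • T.theta = T.const u * T.theta) := by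
  classical
  -- `Π^tp_X` acts on `ℚ̄_pˣ` through `aug`
  letI instA : MulDistribMulAction D.PiTemp (PadicAlgCl p)ˣ :=
    MulDistribMulAction.compHom _ (D.aug.toMonoidHom : D.PiTemp →* GQp p)
  have hsmulA : ∀ (g : D.PiTemp) (u : (PadicAlgCl p)ˣ), g • u = (D.aug.toMonoidHom g) • u := fun _ _ => rfl
  have hsmulA' : ∀ (g : D.PiTemp) (u : (PadicAlgCl p)ˣ), (D.aug g) • u = g • u := fun _ _ => rfl
  /- the degree and the unipotent shift on exponents -/
  let a : D.PiTemp → ℤ := fun g => Multiplicative.toAdd (D.toZ g)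
  have a_mul : ∀ g h, a (g * h) = a g + a h := fun g h => by
    show Multiplicative.toAdd (D.toZ (g * h)) = _; rw [map_mul, toAdd_mul]
  have a_one : a 1 = 0 := by show Multiplicative.toAdd (D.toZ 1) = 0; rw [map_one, toAdd_one]
  have a_of_mem : ∀ {g}, g ∈ D.GtpY → a g = 0 := fun {g} hg => by
    show Multiplicative.toAdd (D.toZ g) = 0; rw [show D.toZ g = 1 from hg, toAdd_one]
  have a_σ₀ : a σ₀ = 1 := by show Multiplicative.toAdd (D.toZ σ₀) = 1; rw [hσ₀, toAdd_ofAdd]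
  let sh : D.PiTemp → Multiplicative ℚ × Multiplicative ℚ → Multiplicative ℚ × Multiplicative ℚ :=
    fun g v => (v.1 * v.2 ^ (-(2 * a g)), v.2)
  have sh_def : ∀ g v, sh g v = (v.1 * v.2 ^ (-(2 * a g)), v.2) := fun _ _ => rfl
  have sh_one : ∀ v, sh 1 v = v := fun v => by rw [sh_def, a_one, mul_zero, neg_zero, zpow_zero, mul_one]
  have sh_mul : ∀ g h v, sh (g * h) v = sh g (sh h v) := fun g h v => by
    simp only [sh_def, a_mul]
    refine Prod.ext ?_ rfl; dsimp only; rw [mul_assoc, ← zpow_add]; congr 2; ring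
  have sh_mul_mul : ∀ g (v v' : Multiplicative ℚ × Multiplicative ℚ), sh g (v * v') = sh g v * sh g v' :=
    fun g v v' => by
    simp only [sh_def, Prod.fst_mul, Prod.snd_mul, Prod.mk_mul_mk, mul_zpow]
    refine Prod.ext ?_ rfl; dsimp only; rw [mul_mul_mul_comm]
  have sh_fst_one : ∀ g (r : Multiplicative ℚ), sh g (r, 1) = (r, 1) := fun g r => by rw [sh_def, one_zpow, mul_one]
  have sh_unit : ∀ g, sh g 1 = 1 := fun g => by rw [sh_def, Prod.snd_one, Prod.fst_one, one_zpow, mul_one]; rfl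
  have sh_of_mem : ∀ {g} (_ : g ∈ D.GtpY) v, sh g v = v := fun {g} hg v => by
    rw [sh_def, a_of_mem hg, mul_zero, neg_zero, zpow_zero, mul_one]
  -- `B 1 = 1` and the cocycle law in the shape `mul_smul` needs
  have hB1 : ∀ v, B 1 v = 1 := fun v => by
    have h := hB 1 1 v
    rw [one_mul, map_one, one_smul, map_one, toAdd_one, mul_zero, zpow_zero, mul_one] at h
    exact mul_left_cancel (a := B 1 v) (by rw [mul_one]; exact h.symm)
  have hBsh : ∀ g h v, B (g * h) (sh (g * h) v) = B g (sh (g * h) v) * g • B h (sh h v) := fun g h v => by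
    rw [hB g h (sh (g * h) v), hsmulA']
    congr 3
    simp only [sh_def, a_mul]
    refine Prod.ext ?_ rfl; dsimp only; rw [mul_assoc, ← zpow_add]; congr 2
    show -(2 * (a g + a h)) + 2 * a g = -(2 * a h); ring
  /- the monomial module `Fn := ℚ̄_pˣ × (ℚ × ℚ)` -/
  letI iS : SMul D.PiTemp ((PadicAlgCl p)ˣ × (Multiplicative ℚ × Multiplicative ℚ)) :=
    ⟨fun g f => (g • f.1 * B g (sh g f.2), sh g f.2)⟩
  have smul_def : ∀ (g : D.PiTemp) (f : (PadicAlgCl p)ˣ × (Multiplicative ℚ × Multiplicative ℚ)),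
      g • f = (g • f.1 * B g (sh g f.2), sh g f.2) := fun _ _ => rfl
  letI instFn : MulDistribMulAction D.PiTemp ((PadicAlgCl p)ˣ × (Multiplicative ℚ × Multiplicative ℚ)) :=
    { one_smul := fun f => Prod.ext (by
        change (1 : D.PiTemp) • f.1 * B 1 (sh 1 f.2) = f.1
        rw [one_smul, hB1, mul_one]) (sh_one f.2)
      mul_smul := fun g h f => Prod.ext (by
        change (g * h) • f.1 * B (g * h) (sh (g * h) f.2) = g • (h • f.1 * B h (sh h f.2)) * B g (sh g (sh h f.2))
        rw [hBsh, ← sh_mul, mul_smul, smul_mul', mul_assoc, mul_comm (B g _) (g • B h _)]) (sh_mul g h f.2)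
      smul_mul := fun g f f' => Prod.ext (by
        change g • (f.1 * f'.1) * B g (sh g (f.2 * f'.2)) = (g • f.1 * B g (sh g f.2)) * (g • f'.1 * B g (sh g f'.2))
        rw [smul_mul', sh_mul_mul, map_mul, mul_mul_mul_comm]) (sh_mul_mul g f.2 f'.2)
      smul_one := fun g => Prod.ext (by
        change g • (1 : (PadicAlgCl p)ˣ) * B g (sh g 1) = 1
        rw [sh_unit, smul_one, map_one, mul_one]) (sh_unit g) }
  -- torsion: members of `Λ(Fn)` have trivial exponents
  have rat_pow_eq_one : ∀ (t : Multiplicative ℚ) (n : ℕ+), t ^ (n : ℕ) = 1 → t = 1 := by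
    intro t n h
    have h' : (n : ℕ) • Multiplicative.toAdd t = 0 := by rw [← toAdd_pow, h, toAdd_one]
    rcases (smul_eq_zero.mp h') with h0 | h0
    · exact absurd h0 n.ne_zero
    · rw [← ofAdd_toAdd t, h0, ofAdd_zero]
  have snd_eq_one : ∀ (ζ : cyclotome ((PadicAlgCl p)ˣ × (Multiplicative ℚ × Multiplicative ℚ))) (n : ℕ+),
      ((ζ : ℕ+ → (PadicAlgCl p)ˣ × (Multiplicative ℚ × Multiplicative ℚ)) n).2 = 1 := by
    intro ζ n
    have h := congrArg Prod.snd (ζ.2.1 n)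
    rw [Prod.pow_snd, Prod.snd_one] at h
    have h1 := congrArg Prod.fst h; have h2 := congrArg Prod.snd h
    rw [Prod.pow_fst, Prod.fst_one] at h1; rw [Prod.pow_snd, Prod.snd_one] at h2
    exact Prod.ext (rat_pow_eq_one _ n h1) (rat_pow_eq_one _ n h2)
  -- open stabilisers
  have hopenA : ∀ u : (PadicAlgCl p)ˣ, IsOpen (MulAction.stabilizer D.PiTemp u : Set D.PiTemp) := by
    intro u
    have h : (MulAction.stabilizer D.PiTemp u : Set D.PiTemp) =
        D.aug ⁻¹' (MulAction.stabilizer (GQp p) u : Set (GQp p)) := by ext g; rfl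
    rw [h]; exact (isOpen_stabilizer_absoluteGaloisGroup_units ℚ_[p] u).preimage (map_continuous D.aug)
  have hopen : ∀ f : (PadicAlgCl p)ˣ × (Multiplicative ℚ × Multiplicative ℚ),
      IsOpen (MulAction.stabilizer D.PiTemp f : Set D.PiTemp) := by
    intro f
    apply Subgroup.isOpen_of_one_mem_interior
    rw [mem_interior]
    refine ⟨(MulAction.stabilizer D.PiTemp f.1 : Set D.PiTemp) ∩ {g : D.PiTemp | g ∈ D.GtpY ∧ B g f.2 = 1},
      fun g hg => ?_, (hopenA f.1).inter (hBopen f.2), ?_⟩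
    · obtain ⟨hg1, hgY, hgB⟩ := hg
      rw [SetLike.mem_coe, MulAction.mem_stabilizer_iff] at hg1 ⊢
      rw [smul_def, sh_of_mem hgY, hgB, mul_one, hg1]
    · exact ⟨by rw [SetLike.mem_coe]; exact one_mem _, one_mem _, hB1 _⟩
  -- the constants `K̈ˣ → Fn`
  let cst : (↥D.Kdd)ˣ →* (PadicAlgCl p)ˣ :=
    Units.map (algebraMap (↥D.Kdd) (PadicAlgCl p) : ↥D.Kdd →* PadicAlgCl p)
  have hcst : ∀ c, (cst c : PadicAlgCl p) = ((c : ↥D.Kdd) : PadicAlgCl p) := fun _ => rfl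
  have hcst_fix : ∀ (c : (↥D.Kdd)ˣ) (h : D.PiTemp), h ∈ D.GtpYdd → h • cst c = cst c := by
    intro c h hh
    rw [hsmulA]
    exact KummerCore.smul_eq_of_coe_mem D.Kdd (cst c) (by rw [hcst]; exact (c : ↥D.Kdd).2) _
      (C.aug_mem_fixingSubgroup_Kdd_of_mem_GtpYdd hh)
  let cstF : (↥D.Kdd)ˣ →* (PadicAlgCl p)ˣ × (Multiplicative ℚ × Multiplicative ℚ) := (MonoidHom.inl _ _).comp cst
  have cstF_apply : ∀ c, cstF c = (cst c, 1) := fun _ => rfl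
  have hcstF_mem : ∀ c, cstF c ∈ MulAction.fixedPoints D.GtpYdd ((PadicAlgCl p)ˣ × (Multiplicative ℚ × Multiplicative ℚ)) := by
    intro c h
    show (h : D.PiTemp) • cstF c = cstF c
    rw [cstF_apply, smul_def, sh_of_mem (D.GtpYdd_le_GtpY h.2), hcst_fix c h h.2, map_one, mul_one]
  have cst_neg_one : cst (-1) = -1 := by
    apply Units.ext; rw [hcst, Units.val_neg, Units.val_one, Units.val_neg, Units.val_one]; push_cast; rfl
  have cst_qdd : cst D.qddUnit = Units.mk0 D.qdd D.qdd_ne_zero := by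
    apply Units.ext; rw [hcst, Units.val_mk0]; rfl
  -- the coefficients `Λ(Fn) = Λ(ℚ̄_pˣ) → Δ_Θ`
  have cont_mapFst : Continuous (cyclotome.map
      (MonoidHom.fst (PadicAlgCl p)ˣ (Multiplicative ℚ × Multiplicative ℚ)) :
        cyclotome ((PadicAlgCl p)ˣ × (Multiplicative ℚ × Multiplicative ℚ)) → cyclotome (PadicAlgCl p)ˣ) :=
    continuous_induced_rng.2 (continuous_pi fun n =>
      continuous_fst.comp ((continuous_apply n).comp continuous_subtype_val))
  have mapFst_smul : ∀ (g : D.PiTemp) (ζ : cyclotome ((PadicAlgCl p)ˣ × (Multiplicative ℚ × Multiplicative ℚ))),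
      cyclotome.map (MonoidHom.fst _ _) (g • ζ) =
        (C.augTheta (D.toTheta g)) • cyclotome.map (MonoidHom.fst _ _) ζ := by
    intro g ζ
    apply Subtype.ext
    funext n
    show (g • (ζ : ℕ+ → (PadicAlgCl p)ˣ × (Multiplicative ℚ × Multiplicative ℚ)) n).1 =
      (C.augTheta (D.toTheta g)) • ((ζ : ℕ+ → (PadicAlgCl p)ˣ × (Multiplicative ℚ × Multiplicative ℚ)) n).1
    rw [smul_def, snd_eq_one, sh_unit, map_one, mul_one, hsmulA, C.augTheta_toTheta]
    rfl
  let coeffT : CyclotomeCoefficients D.toTheta D.DeltaTheta ((PadicAlgCl p)ˣ × (Multiplicative ℚ × Multiplicative ℚ)) :=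
    { hom := C.coeffHom.comp (cyclotome.map (MonoidHom.fst _ _))
      continuous_hom := C.continuous_coeffHom.comp cont_mapFst
      hom_smul := fun g ζ => by
        rw [MonoidHom.comp_apply, MonoidHom.comp_apply, mapFst_smul]
        exact C.coeffHom_smul (D.toTheta g) _ }
  -- rational one-parameter root systems `n ↦ 1/n`
  have root_arith : ∀ n m : ℕ+, (Multiplicative.ofAdd ((1 : ℚ) / ((n * m : ℕ+) : ℕ))) ^ (m : ℕ) =
      Multiplicative.ofAdd ((1 : ℚ) / (n : ℕ)) := by
    intro n m
    rw [← ofAdd_nsmul, nsmul_eq_mul, PNat.mul_coe, Nat.cast_mul]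
    have hn : ((n : ℕ) : ℚ) ≠ 0 := Nat.cast_ne_zero.2 n.ne_zero
    have hm : ((m : ℕ) : ℚ) ≠ 0 := Nat.cast_ne_zero.2 m.ne_zero
    congr 1; field_simp
  have ofAdd_one_one : Multiplicative.ofAdd ((1 : ℚ) / ((1 : ℕ+) : ℕ)) = Multiplicative.ofAdd (1 : ℚ) := by
    rw [PNat.one_coe, Nat.cast_one, div_one]
  -- `Ü := (1, (1, 0))` and `Θ̈ := (1, (0, 1))` with their roots
  let uF : (PadicAlgCl p)ˣ × (Multiplicative ℚ × Multiplicative ℚ) := (1, (Multiplicative.ofAdd 1, 1))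
  let uRootsF : RootSystem uF :=
    { root := fun n => (1, (Multiplicative.ofAdd ((1 : ℚ) / (n : ℕ)), 1))
      root_one := by simp only [uF, ofAdd_one_one]
      root_mul_pow := fun n m => by
        refine Prod.ext (by simp) (Prod.ext ?_ (by simp))
        rw [Prod.pow_snd, Prod.pow_fst, root_arith] }
  let thetaF : (PadicAlgCl p)ˣ × (Multiplicative ℚ × Multiplicative ℚ) := (1, (1, Multiplicative.ofAdd 1))
  let thetaRootsF : RootSystem thetaF :=
    { root := fun n => (1, (1, Multiplicative.ofAdd ((1 : ℚ) / (n : ℕ))))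
      root_one := by simp only [thetaF, ofAdd_one_one]
      root_mul_pow := fun n m => by
        refine Prod.ext (by simp) (Prod.ext (by simp) ?_)
        rw [Prod.pow_snd, Prod.pow_snd, root_arith] }
  -- values of `B` on `Π^tp_Ÿ` at the generators
  have hBYddU : ∀ h ∈ D.GtpYdd, B h (Multiplicative.ofAdd 1, 1) = 1 := fun h hh => by
    have e := hBlogU h hh 1
    rw [ofAdd_one_one, cyclotome.apply_one] at e
    exact e
  have hBYddT : ∀ h ∈ D.GtpYdd, B h (1, Multiplicative.ofAdd 1) = 1 := fun h hh => by
    have e := hBZ h hh 1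
    rw [ofAdd_one_one, cyclotome.apply_one] at e
    exact e
  have u_mem : uF ∈ MulAction.fixedPoints D.GtpYdd ((PadicAlgCl p)ˣ × (Multiplicative ℚ × Multiplicative ℚ)) := by
    intro h; show (h : D.PiTemp) • uF = uF
    rw [smul_def, sh_of_mem (D.GtpYdd_le_GtpY h.2), smul_one, one_mul, hBYddU h h.2]
  have theta_mem : thetaF ∈ MulAction.fixedPoints D.GtpYdd ((PadicAlgCl p)ˣ × (Multiplicative ℚ × Multiplicative ℚ)) := by
    intro h; show (h : D.PiTemp) • thetaF = thetaF
    rw [smul_def, sh_of_mem (D.GtpYdd_le_GtpY h.2), smul_one, one_mul, hBYddT h h.2]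
  -- the input
  let T : D.ThetaKummerInput :=
    { Fn := (PadicAlgCl p)ˣ × (Multiplicative ℚ × Multiplicative ℚ)
      isOpen_stabilizer := hopen
      theta := thetaF
      theta_mem := theta_mem
      thetaRoots := thetaRootsF
      const := cstF
      const_mem := hcstF_mem
      constRoots := fun c =>
        ((RootSystem.ofRootableBy (cst c)).map
          (MonoidHom.inl (PadicAlgCl p)ˣ (Multiplicative ℚ × Multiplicative ℚ))).cast (rfl : _ = cstF c)
      coeff := coeffT }
  -- `±1` as units of `O_K̈`
  have unit_of_sign : ∀ {x : (PadicAlgCl p)ˣ}, (x = 1 ∨ x = -1) → ∃ u ∈ D.unitsOKdd, cst u = x := by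
    rintro x (rfl | rfl)
    · exact ⟨1, one_mem _, map_one _⟩
    · exact ⟨-1, D.neg_one_mem_unitsOKdd, cst_neg_one⟩
  refine ⟨T, uF, u_mem, uRootsF, ?_, ?_, ?_, ?_, ?_, ?_, ?_, ?_⟩
  · -- bijective coefficients: `map fst : Λ(Fn) → Λ(ℚ̄_pˣ)` is a bijection
    refine C.bijective_coeffHom.comp ⟨fun ζ ζ' h => ?_, fun ζ₀ => ⟨cyclotome.map (MonoidHom.inl _ _) ζ₀, ?_⟩⟩
    · refine Subtype.ext (funext fun n => ?_)
      have h1 := congrArg (fun ξ : cyclotome (PadicAlgCl p)ˣ => (ξ : ℕ+ → (PadicAlgCl p)ˣ) n) h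
      simp only [cyclotome.map_apply, MonoidHom.coe_fst] at h1
      exact Prod.ext h1 (by rw [snd_eq_one, snd_eq_one])
    · exact Subtype.ext (funext fun n => rfl)
  · -- `ConstCompat`: the bridge's Kummer class of a constant IS the core's inflated class (same cocycle)
    intro c
    letI := D.unitsAction C.augTheta
    show D.inflTheta D.GtpYdd
        (C.coeff.kummerContMap (D.GtpYdd.map D.toTheta) C.isOpen_stabilizer' (C.toInvYdd c)) =
      T.coeff.kummerContClass D.GtpYdd (T.constRoots c) (T.const_mem c) fun _ => T.isOpen_stabilizer _
    rw [C.coeff.kummerContMap_apply_eq (D.GtpYdd.map D.toTheta) C.isOpen_stabilizer' (C.toInvYdd c)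
      (RootSystem.ofRootableBy ((C.toInvYdd c : C.invYdd) : (PadicAlgCl p)ˣ))]
    show ContH1.infl D.DeltaTheta D.toTheta D.continuous_toTheta le_rfl (ContH1.mk _ _) = ContH1.mk _ _
    refine ContH1.mk_congr D.GtpYdd ?_ _ _
    funext h
    show C.coeffHom ((RootSystem.ofRootableBy ((C.toInvYdd c : C.invYdd) : (PadicAlgCl p)ˣ)).kummerCocycle
        (C.toInvYdd c).2 ⟨D.toTheta h.1, ⟨h.1, h.2, rfl⟩⟩) =
      C.coeffHom (cyclotome.map (MonoidHom.fst _ _)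
        ((((RootSystem.ofRootableBy (cst c)).map
          (MonoidHom.inl (PadicAlgCl p)ˣ (Multiplicative ℚ × Multiplicative ℚ))).cast
          (rfl : _ = cstF c)).kummerCocycle (hcstF_mem c) h))
    congr 1
    apply Subtype.ext
    funext n
    rw [cyclotome.map_apply, RootSystem.kummerCocycle_apply, RootSystem.kummerCocycle_apply, RootSystem.cast_root,
      RootSystem.map_root, MonoidHom.coe_fst]
    show (C.augTheta (D.toTheta h.1)) • (RootSystem.ofRootableBy (cst c)).root n /
        (RootSystem.ofRootableBy (cst c)).root n =
      ((h : D.PiTemp) • (RootSystem.ofRootableBy (cst c)).root n * B (h : D.PiTemp) (sh (h : D.PiTemp) 1)) /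
        (RootSystem.ofRootableBy (cst c)).root n
    rw [sh_unit, map_one, mul_one, hsmulA, C.augTheta_toTheta]
    rfl
  · -- `hlogU`: `infl log(Ü) = κ(Ü)` — on cocycles `ι(ŷ/2) = coeff((B h (1/n, 0))_n)`
    rw [hKU]
    show ContH1.infl D.DeltaTheta D.toTheta D.continuous_toTheta le_rfl (ContH1.mk K.logUddFun K.logUddFun_mem) =
      ContH1.mk _ _
    refine ContH1.mk_congr D.GtpYdd ?_ _ _
    funext h
    show K.iota (SettingModel.half ⟨K.y (D.toTheta h.1), _⟩) =
      C.coeffHom (cyclotome.map (MonoidHom.fst _ _) (uRootsF.kummerCocycle u_mem h))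
    rw [← hKι]
    congr 1
    refine Subtype.ext (funext fun n => Eq.symm ?_)
    rw [cyclotome.map_apply, RootSystem.kummerCocycle_apply, MonoidHom.coe_fst]
    show (((h : D.PiTemp) • (1 : (PadicAlgCl p)ˣ) *
        B (h : D.PiTemp) (sh (h : D.PiTemp) (Multiplicative.ofAdd ((1 : ℚ) / (n : ℕ)), 1))) / 1) = _
    rw [smul_one, one_mul, div_one, sh_of_mem (D.GtpYdd_le_GtpY h.2), hBlogU h.1 h.2 n]
  · -- `hx′`: `infl x′ = κ(Θ̈)` — on cocycles `Z = coeff((B h (0, 1/n))_n)`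
    show ContH1.infl D.DeltaTheta D.toTheta D.continuous_toTheta le_rfl (ContH1.mk _ _) = ContH1.mk _ _
    refine ContH1.mk_congr D.GtpYdd ?_ _ _
    funext h
    show Z ⟨D.toTheta h.1, D.GtpYddTheta_le ⟨h.1, h.2, rfl⟩⟩ =
      C.coeffHom (cyclotome.map (MonoidHom.fst _ _) (thetaRootsF.kummerCocycle theta_mem h))
    have key : cyclotome.map (MonoidHom.fst _ _) (thetaRootsF.kummerCocycle theta_mem h) =
        (MulEquiv.ofBijective C.coeffHom C.bijective_coeffHom).symm
          (Z ⟨D.toTheta h.1, D.GtpYddTheta_le ⟨h.1, h.2, rfl⟩⟩) := by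
      apply Subtype.ext
      funext n
      rw [cyclotome.map_apply, RootSystem.kummerCocycle_apply, MonoidHom.coe_fst]
      show (((h : D.PiTemp) • (1 : (PadicAlgCl p)ˣ) *
          B (h : D.PiTemp) (sh (h : D.PiTemp) (1, Multiplicative.ofAdd ((1 : ℚ) / (n : ℕ))))) / 1) = _
      rw [smul_one, one_mul, div_one, sh_of_mem (D.GtpYdd_le_GtpY h.2), hBZ h.1 h.2 n]
    rw [key]
    exact ((MulEquiv.ofBijective C.coeffHom C.bijective_coeffHom).apply_symm_apply _).symm
  · -- `hU₀`: `σ₀ • Ü = const(u·q̈)·Ü`, `u = ±1`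
    obtain ⟨u, hu, hcu⟩ := unit_of_sign hu₀
    refine ⟨u, hu, ?_⟩
    show σ₀ • uF = cstF (u * D.qddUnit) * uF
    rw [smul_def, cstF_apply, map_mul, hcu, cst_qdd]
    show ((σ₀ • (1 : (PadicAlgCl p)ˣ) * B σ₀ (sh σ₀ (Multiplicative.ofAdd 1, 1)),
        sh σ₀ (Multiplicative.ofAdd 1, 1)) : (PadicAlgCl p)ˣ × (Multiplicative ℚ × Multiplicative ℚ)) =
      (u₀ * Units.mk0 D.qdd D.qdd_ne_zero, 1) * (1, (Multiplicative.ofAdd 1, 1))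
    rw [sh_fst_one, smul_one, one_mul, hB0U, Prod.mk_mul_mk, mul_one, one_mul]
  · -- `hUY`: `y • Ü = const(±1)·Ü` on `Π^tp_Y`
    intro y hy
    obtain ⟨u, hu, hcu⟩ := unit_of_sign (hBYU y hy)
    refine ⟨u, hu, ?_⟩
    show y • uF = cstF u * uF
    rw [smul_def, cstF_apply, hcu, sh_of_mem hy, smul_one, one_mul]
    show ((B y (Multiplicative.ofAdd 1, 1), (Multiplicative.ofAdd (1 : ℚ), (1 : Multiplicative ℚ))) :
        (PadicAlgCl p)ˣ × (Multiplicative ℚ × Multiplicative ℚ)) = _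
    rw [Prod.mk_mul_mk, mul_one, one_mul]
  · -- `hΘ₀`: `σ₀ • Θ̈ = const(q̈⁻¹)·Ü⁻²·Θ̈`
    refine ⟨1, one_mem _, ?_⟩
    show σ₀ • thetaF = cstF (1 * D.qddUnit⁻¹) * uF ^ (-(2 : ℤ)) * thetaF
    have hsh : sh σ₀ (1, Multiplicative.ofAdd 1) = (Multiplicative.ofAdd (-2 : ℚ), Multiplicative.ofAdd 1) := by
      rw [sh_def, a_σ₀, mul_one, one_mul, ← ofAdd_zsmul]
      norm_num
    have hpow : uF ^ (-(2 : ℤ)) = (1, (Multiplicative.ofAdd (-2 : ℚ), 1)) := by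
      show ((1, (Multiplicative.ofAdd (1 : ℚ), (1 : Multiplicative ℚ))) :
          (PadicAlgCl p)ˣ × (Multiplicative ℚ × Multiplicative ℚ)) ^ (-(2 : ℤ)) = _
      refine Prod.ext (by simp) (Prod.ext ?_ (by simp))
      show Multiplicative.ofAdd (1 : ℚ) ^ (-(2 : ℤ)) = Multiplicative.ofAdd (-2 : ℚ)
      rw [← ofAdd_zsmul]; norm_num
    rw [smul_def, one_mul, map_inv, cstF_apply, cst_qdd, hsh, smul_one, one_mul, hB0T, hpow]
    show ((((Units.mk0 D.qdd D.qdd_ne_zero)⁻¹, (Multiplicative.ofAdd (-2 : ℚ), Multiplicative.ofAdd (1 : ℚ)))) :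
        (PadicAlgCl p)ˣ × (Multiplicative ℚ × Multiplicative ℚ)) =
      ((Units.mk0 D.qdd D.qdd_ne_zero, (1 : Multiplicative ℚ × Multiplicative ℚ))⁻¹ *
        (1, (Multiplicative.ofAdd (-2 : ℚ), 1))) * (1, (1, Multiplicative.ofAdd 1))
    ext <;> simp
  · -- `hΘY`: `y • Θ̈ = Θ̈` on `Π^tp_Y`
    intro y hy
    refine ⟨1, one_mem _, ?_⟩
    show y • thetaF = cstF 1 * thetaF
    rw [map_one, one_mul, smul_def, sh_of_mem hy, smul_one, one_mul, hBYT y hy]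

end KummerCore

end ThetaSetting

end Literature.AnabelianGeometry.EtaleTheta

end
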